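import Summits.NavierStokesRegularity.NavierStokesRegularity.Theorems.SymmetryModuliCountForcedSymmetryStubSatelliteExclusionTopPoint
import Summits.NavierStokesRegularity.NavierStokesRegularity.Theorems.SymmetryModuliCountForcedSymmetryStubSatelliteExclusionWeightedSerrin
import Summits.NavierStokesRegularity.NavierStokesRegularity.Theorems.SymmetryModuliCountForcedSymmetryStubSatelliteExclusionTools
import Summits.NavierStokesRegularity.NavierStokesRegularity.Theorems.SymmetryModuliCountForcedSymmetryStubDecayOfSatelliteFree
import Literature.Analysis.FluidPDE.ChaeWolfDSSDecayLtNine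
import Literature.Analysis.FluidPDE.ClassicalSolutionRescale
import Mathlib.Analysis.SpecialFunctions.JapaneseBracket
import HarnessLib

/-!
# Crux `ForcedSymmetry` (stmt-NavierStokesRegularity-4052), line `recurrent-closing`, stub 3a
# `stub_satelliteExclusion`: Chae–Wolf's Theorem 1.1 INSIDE Albritton–Barker's class — the satellite criterion

Support file (theorems only, `--supports stmt-NavierStokesRegularity-4052`; the same stub is stub 1 of crux stmt-8561's line
`birth`).  Lead c6, 2026-08-17.  The registered stub: a smooth profile `(w, q, H)` of `𝒦_C` (suitable weak on the slab,
weak gradient, `𝐈 < ∞`, time rate `C`, classical on `(−∞,0)`), invariant a.e. under `(t,x) ↦ l • R⁻¹ w (l²t) (l R x + ξ)`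
(`l > 1`, `R` a linear isometry), is regular at every final-slice point other than the centre.  Printed model: Chae–Wolf
2017, Thm 1.1 (arXiv:1610.09464, pp. 3, 5–7), where the far field enters through ONE number — the `L^p` norm on a period
strip — via the weighted Serrin estimate (2.5).  Proved here, for EVERY `l > 1`, EVERY isometry `R`, every centre:

* `satelliteExclusion_centred_of_stripIntegrable` — RDSS about the origin (pointwise on `t < 0`) plus
  `∫∫_{(−l²,−1] × ℝ³} ‖w‖^p < ∞` for some `3 < p < 9` ⇒ every `(0, y)`, `y ≠ 0`, is regular (RDSS weighted Serrin estimate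
  `lintegral_weighted_annulus_le_rdss`; Step 4 `ChaeWolfDecay.tendsto_cknC_zero_of_weighted_lt_top` on the annulus
  `√l ≤ |x₀| ≤ l√l`; the in-class [gus] step `not_isBackwardSingularPoint_of_tendsto_cknC`; orbit reduction
  `satelliteExclusion_iff_farField`);
* `satelliteExclusion_of_stripIntegrable` — VERBATIM the hypotheses and conclusion of the registered stub, plus the one
  hypothesis `∫∫_{(−l²,−1] × ℝ³} ‖w‖^p < ∞` (`3 < p < 9`); any centre, by translation to the origin;
* `lintegral_strip_lt_top_of_hasTypeIDecay` — conversely, space–time Type-I decay gives that finiteness for every `p > 3`;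
* `satelliteExclusion_iff_stripIntegrable` — for centred profiles of the class: satellite-free ⇔ `HasTypeIDecay` ⇔ finite
  `L^p` norm (`3 < p < 9`) on one period strip ((a ⇒ b) is the landed scaling step `stub_decayOfSatelliteFree`, p142689).

So the open stub is EXACTLY "RDSS profiles of `𝒦_C ∩ C^∞` have `∫∫_{(−l²,−1]×ℝ³} ‖w‖^p < ∞`"; the disprover's target is an
RDSS Type-I profile whose period strip has infinite `L^p` norm for all `p ∈ (3,9)` (fat far field ⇔ a singular satellite orbit).

References: D. Chae, J. Wolf, Comm. PDE 42 (2017) = arXiv:1610.09464, Thm 1.1, §2 Steps 3–5 [ChaeWolf2017RemovingDSS];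
D. Albritton, T. Barker, JMFM 21 (2019), Def. 2.1, §3 [AlbrittonBarker2019]; S. Gustafson, K. Kang, T.-P. Tsai, CMP 273
(2007), Thm 1.1 [GustafsonKangTsai2007].
-/

noncomputable section

-- the summit and its single sub-problem share the name (CONVENTIONS §1), as in every Theorems file
set_option linter.dupNamespace false

open MeasureTheory Set Function Metric Filter Topology
open scoped ENNReal NNReal
open Literature.Analysis.FluidPDE

namespace Summit.NavierStokesRegularity.NavierStokesRegularity.Theorems.SymmetryModuliCountForcedSymmetry

/-! ### Finiteness of the weighted integral on the annulus of the squared similarity -/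

/-- **The weighted Serrin integral of an RDSS field is finite on the annulus `1 ≤ |x| < l²`** as soon as
`∫∫_{(−l²,−1] × ℝ³} ‖w‖^p < ∞`: apply (2.5) to the squared similarity `(l², R ≫ R)` (all of whose integer powers are
invariances, `exists_rdssInv_zpow`) and feed it the strip `(−l⁴, −1]` (`lintegral_strip_sq_lt_top_of_rdss`).
[cite: ChaeWolf2017RemovingDSS, §2 Step 3, (2.5) (arXiv p. 6)] -/
theorem weighted_annulus_sq_lt_top_of_stripIntegrable
    {w : ℝ → EuclideanSpace ℝ (Fin 3) → EuclideanSpace ℝ (Fin 3)} {l : ℝ} (hl : 1 < l)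
    (R : EuclideanSpace ℝ (Fin 3) ≃ₗᵢ[ℝ] EuclideanSpace ℝ (Fin 3))
    (hinv : ∀ t < (0 : ℝ), ∀ x : EuclideanSpace ℝ (Fin 3), l • R.symm (w (l ^ 2 * t) (l • R x)) = w t x)
    {p : ℝ} (hp : 0 < p)
    (hfin : ∫⁻ z in Ioc (-l ^ 2) (-1) ×ˢ (univ : Set (EuclideanSpace ℝ (Fin 3))), ‖w z.1 z.2‖ₑ ^ p < ⊤) :
    ∫⁻ z in Iio (0 : ℝ) ×ˢ {x : EuclideanSpace ℝ (Fin 3) | 1 ≤ ‖x‖ ∧ ‖x‖ < l ^ 2},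
        ‖w z.1 z.2‖ₑ ^ p * ENNReal.ofReal ((-z.1) ^ ((p - 5) / 2)) < ⊤ := by
  have hl0 : 0 < l := one_pos.trans hl
  have hl2 : 1 < l ^ 2 := by nlinarith
  -- the squared similarity and its powers
  have hinv2 : ∀ t < (0 : ℝ), ∀ x : EuclideanSpace ℝ (Fin 3),
      (l ^ 2) • (R.trans R).symm (w ((l ^ 2) ^ 2 * t) ((l ^ 2) • (R.trans R) x)) = w t x := by
    have h := rdssInv_comp hl0 R R hinv hinv
    rwa [← sq] at h
  have hfam := exists_rdssInv_zpow (w := w) (by positivity : 0 < l ^ 2) (R.trans R) hinv2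
  have hstrip := lintegral_strip_sq_lt_top_of_rdss hl R hinv hp hfin
  refine lt_of_le_of_lt (lintegral_weighted_annulus_le_rdss hl2 hfam hp) ?_
  exact ENNReal.mul_lt_top ENNReal.ofReal_lt_top hstrip

/-! ### Satellite exclusion about the origin -/

/-- A nonzero point is not the centre of a similarity `y ↦ l R y` with `l > 1`. [folklore] -/
theorem ne_smul_isometry_of_ne_zero {l : ℝ} (hl : 1 < l)
    (R : EuclideanSpace ℝ (Fin 3) ≃ₗᵢ[ℝ] EuclideanSpace ℝ (Fin 3)) {y : EuclideanSpace ℝ (Fin 3)} (hy : y ≠ 0) :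
    y ≠ l • R y := by
  intro h
  have hn : ‖y‖ = l * ‖y‖ := by
    conv_lhs => rw [h]
    rw [norm_smul, LinearIsometryEquiv.norm_map, Real.norm_of_nonneg (zero_le_one.trans hl.le)]
  have : (l - 1) * ‖y‖ = 0 := by linarith
  rcases mul_eq_zero.1 this with h1 | h1
  · linarith
  · exact hy (norm_eq_zero.1 h1)

/-- **Chae–Wolf's Theorem 1.1 inside Albritton–Barker's class, centred form.**  Let `(w, q)` be a suitable weak solution
on `ℝ³ × (−∞,0)` with weak gradient `H` and `𝐈(ℝ³ × ℝ₋) < ∞`, classical on `(−∞,0)`, invariant on `t < 0` under the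
similarity `(t, x) ↦ l • R⁻¹ w (l² t) (l R x)` with ANY factor `l > 1` and ANY linear isometry `R`.  If
`∫∫_{(−l²,−1] × ℝ³} ‖w‖^p < ∞` for some `3 < p < 9`, then every final-slice point `(0, y)`, `y ≠ 0`, is regular.
Proof: the weighted Serrin integral is finite on `{1 ≤ |x| < l²}` (`weighted_annulus_sq_lt_top_of_stripIntegrable`), so
`C(r; (0, x₀)) → 0` at every `x₀` of the closed annulus `√l ≤ |x₀| ≤ l√l` (`ChaeWolfDecay.tendsto_cknC_zero_of_weighted_lt_top`),
whence those points are regular (`not_isBackwardSingularPoint_of_tendsto_cknC`, the in-class [gus] step); every other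
`y ≠ 0` is pulled into that annulus along the inverse orbit (`satelliteExclusion_iff_farField`).  No Type-I time rate and
no smallness of `l − 1` is used. [cite: ChaeWolf2017RemovingDSS, Thm 1.1 and its proof §2 (arXiv pp. 3, 5–7); AlbrittonBarker2019, Def. 2.1, §3] -/
theorem satelliteExclusion_centred_of_stripIntegrable
    {w : ℝ → EuclideanSpace ℝ (Fin 3) → EuclideanSpace ℝ (Fin 3)} {q : ℝ → EuclideanSpace ℝ (Fin 3) → ℝ}
    {H : ℝ → EuclideanSpace ℝ (Fin 3) → EuclideanSpace ℝ (Fin 3) →L[ℝ] EuclideanSpace ℝ (Fin 3)}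
    (hsw : IsSuitableWeakSolutionOn (slab (EuclideanSpace ℝ (Fin 3)) (Iio (0 : ℝ)) isOpen_Iio) 1 0 w q)
    (hwg : HasWeakSpatialGradientOn (slab (EuclideanSpace ℝ (Fin 3)) (Iio (0 : ℝ)) isOpen_Iio) w H)
    (hI : typeIBound (Iio (0 : ℝ) ×ˢ (univ : Set (EuclideanSpace ℝ (Fin 3)))) w q H < ⊤)
    (hcl : IsClassicalNSSolutionOn (Iio 0) 1 0 w q)
    {l : ℝ} (hl : 1 < l) (R : EuclideanSpace ℝ (Fin 3) ≃ₗᵢ[ℝ] EuclideanSpace ℝ (Fin 3))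
    (hinv : ∀ t < (0 : ℝ), ∀ x : EuclideanSpace ℝ (Fin 3), l • R.symm (w (l ^ 2 * t) (l • R x)) = w t x)
    {p : ℝ} (hp3 : 3 < p) (hp9 : p < 9)
    (hfin : ∫⁻ z in Ioc (-l ^ 2) (-1) ×ˢ (univ : Set (EuclideanSpace ℝ (Fin 3))), ‖w z.1 z.2‖ₑ ^ p < ⊤) :
    ∀ y : EuclideanSpace ℝ (Fin 3), y ≠ 0 → ¬ IsBackwardSingularPoint w ((0 : ℝ), y) := by
  have hl0 : 0 < l := one_pos.trans hl
  have hp0 : 0 < p := by linarith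
  have hcont : ContinuousOn (uncurry w) (Iio (0 : ℝ) ×ˢ univ) := hcl.smooth_velocity.continuousOn
  set D : Set (EuclideanSpace ℝ (Fin 3)) := {x | 1 ≤ ‖x‖ ∧ ‖x‖ < l ^ 2} with hD
  have hDm : MeasurableSet D := ChaeWolfDecay.measurableSet_annulus 1 (l ^ 2)
  have hW := weighted_annulus_sq_lt_top_of_stripIntegrable hl R hinv hp0 hfin
  -- the closed annulus of top points `a ≤ |x₀| ≤ l a`, `a = √l`, with its balls of radius `ρ` inside `D`
  set a : ℝ := Real.sqrt l with ha
  have ha1 : 1 < a := by rw [ha]; exact Real.lt_sqrt_of_sq_lt (by simpa using hl)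
  have ha0 : 0 < a := one_pos.trans ha1
  have hal : l * a < l ^ 2 := by
    have : a < l := by
      rw [ha, Real.sqrt_lt' hl0]; nlinarith
    nlinarith
  set ρ : ℝ := min (a - 1) (l ^ 2 - l * a) / 2 with hρ
  have hρ0 : 0 < ρ := by rw [hρ]; exact half_pos (lt_min (by linarith) (by linarith))
  have hρa : ρ < a - 1 := by
    rw [hρ]
    linarith [min_le_left (a - 1) (l ^ 2 - l * a),
      lt_min (by linarith : (0:ℝ) < a - 1) (by linarith : (0:ℝ) < l ^ 2 - l * a)]
  have hρl : ρ < l ^ 2 - l * a := by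
    rw [hρ]
    linarith [min_le_right (a - 1) (l ^ 2 - l * a),
      lt_min (by linarith : (0:ℝ) < a - 1) (by linarith : (0:ℝ) < l ^ 2 - l * a)]
  have hballD : ∀ x₀ : EuclideanSpace ℝ (Fin 3), a ≤ ‖x₀‖ → ‖x₀‖ ≤ l * a → ball x₀ ρ ⊆ D := by
    intro x₀ h1 h2 y hy
    rw [mem_ball, dist_eq_norm] at hy
    have hlow : ‖x₀‖ - ‖y - x₀‖ ≤ ‖y‖ := by
      linarith [abs_norm_sub_norm_le x₀ y, norm_sub_rev x₀ y, abs_le.1 (abs_norm_sub_norm_le x₀ y)]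
    have hup : ‖y‖ ≤ ‖x₀‖ + ‖y - x₀‖ := by
      have := norm_add_le x₀ (y - x₀); rwa [add_sub_cancel] at this
    exact ⟨by linarith, by linarith⟩
  have hreg : ∀ x₀ : EuclideanSpace ℝ (Fin 3), a ≤ ‖x₀‖ → ‖x₀‖ ≤ l * a →
      ¬ IsBackwardSingularPoint w ((0 : ℝ), x₀) := by
    intro x₀ h1 h2
    have hlim := ChaeWolfDecay.tendsto_cknC_zero_of_weighted_lt_top hcont hDm hp3 hp9 hW x₀ hρ0 (hballD x₀ h1 h2)
    exact not_isBackwardSingularPoint_of_tendsto_cknC hsw hwg hI x₀ hlim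
  have hinv0 : ∀ t < (0 : ℝ), ∀ x : EuclideanSpace ℝ (Fin 3), l • R.symm (w (l ^ 2 * t) (l • R x + 0)) = w t x := by
    simpa only [add_zero] using hinv
  have hfar : ∃ r : ℝ, ∀ y : EuclideanSpace ℝ (Fin 3), r ≤ ‖y - 0‖ → ¬ IsBackwardSingularPoint w ((0 : ℝ), y) := by
    refine ⟨a, fun y hy hsing => ?_⟩
    rw [sub_zero] at hy
    obtain ⟨n, hn1, hn2⟩ := exists_nat_pow_near ((one_le_div ha0).2 hy) hl
    set y' : EuclideanSpace ℝ (Fin 3) :=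
      (fun y : EuclideanSpace ℝ (Fin 3) => R.symm (l⁻¹ • (y - 0)))^[n] y with hy'
    have hnorm : ‖y' - 0‖ = (l ^ n)⁻¹ * ‖y - 0‖ :=
      norm_rdss_inverse_iterate_sub_centre hl0 R 0 (c := 0) (by simp) n y
    rw [sub_zero, sub_zero] at hnorm
    have hpow : 0 < l ^ n := pow_pos hl0 n
    have h1 : a ≤ ‖y'‖ := by
      rw [hnorm, le_inv_mul_iff₀ hpow]
      rw [le_div_iff₀ ha0] at hn1
      linarith
    have h2 : ‖y'‖ ≤ l * a := by
      rw [hnorm, inv_mul_le_iff₀ hpow]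
      rw [div_lt_iff₀ ha0, pow_succ] at hn2
      nlinarith
    have hsing' : IsBackwardSingularPoint w ((0 : ℝ), y') := by
      rw [isBackwardSingularPoint_rdss_iterate_iff R 0 hl0 hinv0 n y', hy',
        rdss_iterate_apply_inverse_iterate hl0.ne' R 0 n y]
      exact hsing
    exact hreg y' h1 h2 hsing'
  intro y hy
  have hsat := (satelliteExclusion_iff_farField R 0 hl hinv0 (c := 0) (by simp)).2 hfar
  exact hsat y (by simpa only [add_zero] using ne_smul_isometry_of_ne_zero hl R hy)

/-! ### Any centre, by translation; the registered signature plus one integrability hypothesis -/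

/-- Translating in space preserves `∫∫_{I × ℝ³} ‖w‖^p`. [folklore] -/
theorem lintegral_strip_translate (w : ℝ → EuclideanSpace ℝ (Fin 3) → EuclideanSpace ℝ (Fin 3))
    (c : EuclideanSpace ℝ (Fin 3)) (I : Set ℝ) (p : ℝ) :
    ∫⁻ z in I ×ˢ (univ : Set (EuclideanSpace ℝ (Fin 3))),
        ‖((1 : ℝ) • stPull ((1 : ℝ) ^ 2) 1 0 c w) z.1 z.2‖ₑ ^ p =
      ∫⁻ z in I ×ˢ (univ : Set (EuclideanSpace ℝ (Fin 3))), ‖w z.1 z.2‖ₑ ^ p := by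
  have hpre : stAffine ((1 : ℝ) ^ 2) 1 0 c ⁻¹' (I ×ˢ (univ : Set (EuclideanSpace ℝ (Fin 3)))) =
      I ×ˢ (univ : Set (EuclideanSpace ℝ (Fin 3))) := by
    ext ⟨t, x⟩
    simp only [mem_preimage, stAffine_apply, mem_prod, mem_univ, and_true, one_pow, one_mul, zero_add]
  have h := setLIntegral_preimage_comp_stAffine (E := EuclideanSpace ℝ (Fin 3)) (by norm_num : (0 : ℝ) < 1 ^ 2)
    one_pos 0 c (fun z => ‖w z.1 z.2‖ₑ ^ p) (I ×ˢ univ)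
  rw [hpre, finrank_euclideanSpace_fin] at h
  simp only [one_pow, mul_one, inv_one, ENNReal.ofReal_one, one_mul, stAffine_fst, stAffine_snd, one_smul,
    zero_add] at h
  rw [← h]
  refine lintegral_congr fun z => ?_
  simp only [smul_stPull_apply, one_smul, one_pow, one_mul, zero_add]

/-- **Chae–Wolf's Theorem 1.1 inside the class: `stub_satelliteExclusion` with ONE integrability hypothesis.**
Verbatim the hypotheses of the registered stub `stub_satelliteExclusion` (a smooth profile `(w, q, H)` of `𝒦_C` —
suitable weak on the slab, weak gradient, `𝐈 < ∞`, time rate `C`, classical on `(−∞,0)` — invariant a.e. on the slab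
under `(t,x) ↦ l • R⁻¹ w (l²t) (l R x + ξ)`, ANY `l > 1`, ANY isometry `R`, any `ξ`), PLUS finiteness of the `L^p` norm on
one period strip, `∫∫_{(−l²,−1] × ℝ³} ‖w‖^p < ∞` for some `3 < p < 9`.  Conclusion: verbatim that of the stub — every
final-slice point other than the centre is regular.  (The time rate `C` is not used.)  Reduction to the centred form by
translating the centre `c = l R c + ξ` to the origin (the class, `𝐈`, classical solutions, strip integrals and
backward singular points are translation covariant). [cite: ChaeWolf2017RemovingDSS, Thm 1.1 (arXiv p. 3); AlbrittonBarker2019, §3] -/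
theorem satelliteExclusion_of_stripIntegrable :
    ∀ (w : ℝ → EuclideanSpace ℝ (Fin 3) → EuclideanSpace ℝ (Fin 3)) (q : ℝ → EuclideanSpace ℝ (Fin 3) → ℝ)
      (H : ℝ → EuclideanSpace ℝ (Fin 3) → EuclideanSpace ℝ (Fin 3) →L[ℝ] EuclideanSpace ℝ (Fin 3)) (C : ℝ),
      IsSuitableWeakSolutionOn (slab (EuclideanSpace ℝ (Fin 3)) (Set.Iio 0) isOpen_Iio) 1 0 w q →
      HasWeakSpatialGradientOn (slab (EuclideanSpace ℝ (Fin 3)) (Set.Iio 0) isOpen_Iio) w H →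
      typeIBound (Set.Iio (0 : ℝ) ×ˢ Set.univ) w q H < ⊤ →
      HasTypeITimeDecay C w →
      IsClassicalNSSolutionOn (Set.Iio 0) 1 0 w q →
      ∀ (l : ℝ) (R : EuclideanSpace ℝ (Fin 3) ≃ₗᵢ[ℝ] EuclideanSpace ℝ (Fin 3)) (ξ : EuclideanSpace ℝ (Fin 3)), 1 < l →
        (fun z : ℝ × EuclideanSpace ℝ (Fin 3) => l • R.symm (w (l ^ 2 * z.1) (l • R z.2 + ξ)))
          =ᵐ[volume.restrict (Set.Iio (0 : ℝ) ×ˢ Set.univ)] (fun z : ℝ × EuclideanSpace ℝ (Fin 3) => w z.1 z.2) →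
        ∀ p : ℝ, 3 < p → p < 9 →
          ∫⁻ z in Set.Ioc (-l ^ 2) (-1) ×ˢ (Set.univ : Set (EuclideanSpace ℝ (Fin 3))), ‖w z.1 z.2‖ₑ ^ p < ⊤ →
        ∀ y : EuclideanSpace ℝ (Fin 3), y ≠ l • R y + ξ → ¬ IsBackwardSingularPoint w ((0 : ℝ), y) := by
  intro w q H C hsw hwg hI _hdec hcl l R ξ hl hae p hp3 hp9 hfin y hy
  have hl0 : 0 < l := one_pos.trans hl
  -- pointwise invariance on `t < 0`
  have hae' : (fun z : ℝ × EuclideanSpace ℝ (Fin 3) => l • R.symm (w (l ^ 2 * z.1 + 0) (l • R z.2 + ξ)))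
      =ᵐ[volume.restrict (Iio (0 : ℝ) ×ˢ (univ : Set (EuclideanSpace ℝ (Fin 3))))]
      (fun z : ℝ × EuclideanSpace ℝ (Fin 3) => w z.1 z.2) := by
    simpa only [add_zero] using hae
  have hinvξ : ∀ t < (0 : ℝ), ∀ x : EuclideanSpace ℝ (Fin 3), l • R.symm (w (l ^ 2 * t) (l • R x + ξ)) = w t x := by
    intro t ht x
    simpa only [add_zero] using rdssInvariant_pointwise_of_classical R ξ hcl hl0 le_rfl hae' t ht x
  -- the centre
  obtain ⟨c, hc, -⟩ := exists_unique_rdssCentre hl R ξ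
  have hyc : y ≠ c := fun h => hy (by rw [h]; exact hc)
  -- the translated profile `w₁(t, x) = w(t, c + x)`
  set w₁ : ℝ → EuclideanSpace ℝ (Fin 3) → EuclideanSpace ℝ (Fin 3) := (1 : ℝ) • stPull ((1 : ℝ) ^ 2) 1 0 c w with hw₁
  set q₁ : ℝ → EuclideanSpace ℝ (Fin 3) → ℝ := (1 : ℝ) ^ 2 • stPull ((1 : ℝ) ^ 2) 1 0 c q with hq₁
  set H₁ : ℝ → EuclideanSpace ℝ (Fin 3) → EuclideanSpace ℝ (Fin 3) →L[ℝ] EuclideanSpace ℝ (Fin 3) :=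
    (1 : ℝ) ^ 2 • stPull ((1 : ℝ) ^ 2) 1 0 c H with hH₁
  have hw₁_apply : ∀ t x, w₁ t x = w t (c + x) := fun t x => by
    simp only [hw₁, stPull_apply, one_smul, one_pow, one_mul, zero_add]
  have hsw₁ : IsSuitableWeakSolutionOn (slab (EuclideanSpace ℝ (Fin 3)) (Iio (0 : ℝ)) isOpen_Iio) 1 0 w₁ q₁ := by
    have h := zoom_isSuitableWeakSolutionOn hsw one_pos 0 c
    rwa [stPreimage_one_slab_eq c] at h
  have hwg₁ : HasWeakSpatialGradientOn (slab (EuclideanSpace ℝ (Fin 3)) (Iio (0 : ℝ)) isOpen_Iio) w₁ H₁ := by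
    have h := zoom_hasWeakSpatialGradientOn hwg one_pos 0 c
    rwa [stPreimage_one_slab_eq c] at h
  have hI₁ : typeIBound (Iio (0 : ℝ) ×ˢ (univ : Set (EuclideanSpace ℝ (Fin 3)))) w₁ q₁ H₁ < ⊤ := by
    have h := typeIBound_nsZoom one_pos 0 c (Iio (0 : ℝ) ×ˢ (univ : Set (EuclideanSpace ℝ (Fin 3)))) w q H
    rw [stAffine_one_preimage_lowerHalf' c] at h
    rw [hw₁, hq₁, hH₁, h]
    exact hI
  have hcl₁ : IsClassicalNSSolutionOn (Iio 0) 1 0 w₁ q₁ := by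
    have h := hcl.nsRescale_translate_zero one_pos 0 c
    have e : (fun r : ℝ => (0 : ℝ) + (1 : ℝ) ^ 2 * r) ⁻¹' Iio (0 : ℝ) = Iio 0 := by
      ext r; simp
    rwa [e] at h
  have hinv₁ : ∀ t < (0 : ℝ), ∀ x : EuclideanSpace ℝ (Fin 3), l • R.symm (w₁ (l ^ 2 * t) (l • R x)) = w₁ t x := by
    intro t ht x
    rw [hw₁_apply, hw₁_apply]
    have e : c + l • R x = l • R (c + x) + ξ := by
      conv_lhs => rw [hc]
      rw [map_add, smul_add]
      abel
    rw [e]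
    exact hinvξ t ht (c + x)
  have hfin₁ : ∫⁻ z in Ioc (-l ^ 2) (-1) ×ˢ (univ : Set (EuclideanSpace ℝ (Fin 3))), ‖w₁ z.1 z.2‖ₑ ^ p < ⊤ := by
    rw [hw₁, lintegral_strip_translate w c _ p]
    exact hfin
  have hreg₁ := satelliteExclusion_centred_of_stripIntegrable hsw₁ hwg₁ hI₁ hcl₁ hl R hinv₁ hp3 hp9 hfin₁
    (y - c) (sub_ne_zero.2 hyc)
  intro hsing
  apply hreg₁
  intro r hr
  have h0 : stAffine ((1 : ℝ) ^ 2) 1 0 c (((0 : ℝ), y - c) : ℝ × EuclideanSpace ℝ (Fin 3)) = ((0 : ℝ), y) := by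
    simp [stAffine]
  rw [hw₁, eLpNorm_top_nsZoom one_pos 0 c r ((0 : ℝ), y - c) w, one_mul, h0, hsing r hr, ENNReal.ofReal_one, one_mul]

/-! ### The converse: space–time Type-I decay gives strip integrability -/

/-- **Space–time Type-I decay ⇒ finite `L^p` norm on every compact strip**, `p > 3`: on `[a, b] × ℝ³` with `b < 0`,
`‖w(t,x)‖ ≤ C₀/(‖x‖ + √(−b))`, and `∫_{ℝ³} (‖x‖ + s)^{−p} dx < ∞` for `p > 3 = dim` (Mathlib's
`finite_integral_one_add_norm`). [folklore] -/
theorem lintegral_strip_lt_top_of_hasTypeIDecay {w : ℝ → EuclideanSpace ℝ (Fin 3) → EuclideanSpace ℝ (Fin 3)}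
    {C₀ : ℝ} (hdec : HasTypeIDecay C₀ w) {p : ℝ} (hp : 3 < p) {a b : ℝ} (hb : b < 0) :
    ∫⁻ z in Ioc a b ×ˢ (univ : Set (EuclideanSpace ℝ (Fin 3))), ‖w z.1 z.2‖ₑ ^ p < ⊤ := by
  have hp0 : 0 < p := by linarith
  set s : ℝ := Real.sqrt (-b) with hs
  have hs0 : 0 < s := Real.sqrt_pos.2 (by linarith)
  set m : ℝ := min 1 s with hm
  have hm0 : 0 < m := lt_min one_pos hs0
  set K : ℝ := (|C₀| / m) ^ p with hK
  have hK0 : 0 ≤ K := by positivity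
  -- pointwise bound on the strip
  have hpt : ∀ z ∈ Ioc a b ×ˢ (univ : Set (EuclideanSpace ℝ (Fin 3))),
      ‖w z.1 z.2‖ₑ ^ p ≤ ENNReal.ofReal (K * (1 + ‖z.2‖) ^ (-p)) := by
    rintro ⟨t, x⟩ ⟨ht, -⟩
    have ht0 : t < 0 := lt_of_le_of_lt ht.2 hb
    have hden : 0 < ‖x‖ + Real.sqrt (-t) := add_pos_of_nonneg_of_pos (norm_nonneg _) (Real.sqrt_pos.2 (by linarith))
    have h1 : ‖w t x‖ ≤ |C₀| / (‖x‖ + Real.sqrt (-t)) :=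
      (hdec t ht0 x).trans (div_le_div_of_nonneg_right (le_abs_self C₀) hden.le)
    have hst : s ≤ Real.sqrt (-t) := Real.sqrt_le_sqrt (by linarith [ht.2])
    have h2 : m * (1 + ‖x‖) ≤ ‖x‖ + Real.sqrt (-t) := by
      have hm1 : m ≤ 1 := min_le_left _ _
      have hms : m ≤ s := min_le_right _ _
      nlinarith [norm_nonneg x]
    have h3 : ‖w t x‖ ≤ |C₀| / m * (1 + ‖x‖) ^ (-1 : ℝ) := by
      rw [Real.rpow_neg_one, ← div_eq_mul_inv, div_div]
      exact h1.trans (div_le_div_of_nonneg_left (abs_nonneg _) (by positivity) h2)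
    have h4 : ‖w t x‖ ^ p ≤ K * (1 + ‖x‖) ^ (-p) := by
      calc ‖w t x‖ ^ p ≤ (|C₀| / m * (1 + ‖x‖) ^ (-1 : ℝ)) ^ p :=
            Real.rpow_le_rpow (norm_nonneg _) h3 hp0.le
        _ = K * (1 + ‖x‖) ^ (-p) := by
            rw [Real.mul_rpow (by positivity) (Real.rpow_nonneg (by positivity) _), hK, ← Real.rpow_mul (by positivity)]
            norm_num
    calc ‖w t x‖ₑ ^ p = ENNReal.ofReal (‖w t x‖ ^ p) := by
          rw [← ofReal_norm, ENNReal.ofReal_rpow_of_nonneg (norm_nonneg _) hp0.le]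
      _ ≤ ENNReal.ofReal (K * (1 + ‖x‖) ^ (-p)) := ENNReal.ofReal_le_ofReal h4
  -- integrate
  have hmeas : Measurable fun z : ℝ × EuclideanSpace ℝ (Fin 3) => ENNReal.ofReal (K * (1 + ‖z.2‖) ^ (-p)) := by
    refine ENNReal.measurable_ofReal.comp ?_
    exact measurable_const.mul ((measurable_const.add measurable_snd.norm).pow_const _)
  have hvol : (volume : Measure (ℝ × EuclideanSpace ℝ (Fin 3))) =
      (volume : Measure ℝ).prod (volume : Measure (EuclideanSpace ℝ (Fin 3))) := rfl
  calc ∫⁻ z in Ioc a b ×ˢ (univ : Set (EuclideanSpace ℝ (Fin 3))), ‖w z.1 z.2‖ₑ ^ p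
      ≤ ∫⁻ z in Ioc a b ×ˢ (univ : Set (EuclideanSpace ℝ (Fin 3))), ENNReal.ofReal (K * (1 + ‖z.2‖) ^ (-p)) :=
        lintegral_mono_ae ((ae_restrict_mem (measurableSet_Ioc.prod MeasurableSet.univ)).mono hpt)
    _ = ∫⁻ _t in Ioc a b, ∫⁻ x in (univ : Set (EuclideanSpace ℝ (Fin 3))), ENNReal.ofReal (K * (1 + ‖x‖) ^ (-p)) := by
        rw [hvol, ← Measure.prod_restrict, lintegral_prod _ hmeas.aemeasurable]
    _ = volume (Ioc a b) * ∫⁻ x : EuclideanSpace ℝ (Fin 3), ENNReal.ofReal (K * (1 + ‖x‖) ^ (-p)) := by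
        rw [Measure.restrict_univ, setLIntegral_const, mul_comm]
    _ < ⊤ := by
        refine ENNReal.mul_lt_top (measure_Ioc_lt_top) ?_
        have hfin := finite_integral_one_add_norm (E := EuclideanSpace ℝ (Fin 3)) (μ := volume) (r := p)
          (by rw [finrank_euclideanSpace_fin]; exact_mod_cast hp)
        calc ∫⁻ x : EuclideanSpace ℝ (Fin 3), ENNReal.ofReal (K * (1 + ‖x‖) ^ (-p))
            = ∫⁻ x : EuclideanSpace ℝ (Fin 3), ENNReal.ofReal K * ENNReal.ofReal ((1 + ‖x‖) ^ (-p)) := by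
              refine lintegral_congr fun x => ?_
              rw [ENNReal.ofReal_mul hK0]
          _ = ENNReal.ofReal K * ∫⁻ x : EuclideanSpace ℝ (Fin 3), ENNReal.ofReal ((1 + ‖x‖) ^ (-p)) :=
              lintegral_const_mul' _ _ ENNReal.ofReal_ne_top
          _ < ⊤ := ENNReal.mul_lt_top ENNReal.ofReal_lt_top hfin

/-! ### The satellite criterion: three equivalent forms for centred profiles of the class -/

/-- **The satellite criterion (Chae–Wolf's Theorem 1.1 inside Albritton–Barker's class, as an equivalence).**  For a
smooth profile `(w, q, H)` of `𝒦_C` (suitable weak on the slab, weak gradient, `𝐈 < ∞`, time rate `C`, classical on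
`(−∞,0)`) which is RDSS about the ORIGIN a.e. on the slab with ANY factor `l > 1` and ANY isometry `R`, the following are
equivalent: (a) satellite-freeness — every final-slice point `(0, y)`, `y ≠ l R y` (i.e. `y ≠ 0`), is regular;
(b) space–time Type-I decay `‖w(t,x)‖ ≤ C₀/(‖x‖ + √(−t))` for some `C₀`; (c) `∫∫_{(−l²,−1] × ℝ³} ‖w‖^p < ∞` for some
`3 < p < 9`.  (a ⇒ b) is Chae–Wolf's scaling step (the landed `stub_decayOfSatelliteFree`, which uses the time rate);
(b ⇒ c) is `lintegral_strip_lt_top_of_hasTypeIDecay`; (c ⇒ a) is `satelliteExclusion_centred_of_stripIntegrable`.  So the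
open stub `stub_satelliteExclusion` is EXACTLY the statement that RDSS profiles of the class have finite `L^p` norm
(`3 < p < 9`) on one period strip. [cite: ChaeWolf2017RemovingDSS, Thm 1.1 with (1.5) (arXiv p. 3); AlbrittonBarker2019, §3] -/
theorem satelliteExclusion_iff_stripIntegrable
    {w : ℝ → EuclideanSpace ℝ (Fin 3) → EuclideanSpace ℝ (Fin 3)} {q : ℝ → EuclideanSpace ℝ (Fin 3) → ℝ}
    {H : ℝ → EuclideanSpace ℝ (Fin 3) → EuclideanSpace ℝ (Fin 3) →L[ℝ] EuclideanSpace ℝ (Fin 3)} {C : ℝ}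
    (hsw : IsSuitableWeakSolutionOn (slab (EuclideanSpace ℝ (Fin 3)) (Iio (0 : ℝ)) isOpen_Iio) 1 0 w q)
    (hwg : HasWeakSpatialGradientOn (slab (EuclideanSpace ℝ (Fin 3)) (Iio (0 : ℝ)) isOpen_Iio) w H)
    (hI : typeIBound (Iio (0 : ℝ) ×ˢ (univ : Set (EuclideanSpace ℝ (Fin 3)))) w q H < ⊤)
    (hdec : HasTypeITimeDecay C w) (hcl : IsClassicalNSSolutionOn (Iio 0) 1 0 w q)
    {l : ℝ} (hl : 1 < l) (R : EuclideanSpace ℝ (Fin 3) ≃ₗᵢ[ℝ] EuclideanSpace ℝ (Fin 3))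
    (hae : (fun z : ℝ × EuclideanSpace ℝ (Fin 3) => l • R.symm (w (l ^ 2 * z.1) (l • R z.2)))
      =ᵐ[volume.restrict (Iio (0 : ℝ) ×ˢ (univ : Set (EuclideanSpace ℝ (Fin 3))))]
      (fun z : ℝ × EuclideanSpace ℝ (Fin 3) => w z.1 z.2)) :
    ((∀ y : EuclideanSpace ℝ (Fin 3), y ≠ l • R y → ¬ IsBackwardSingularPoint w ((0 : ℝ), y)) ↔
        ∃ C₀ : ℝ, HasTypeIDecay C₀ w) ∧
      ((∃ C₀ : ℝ, HasTypeIDecay C₀ w) ↔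
        ∃ p : ℝ, 3 < p ∧ p < 9 ∧
          ∫⁻ z in Ioc (-l ^ 2) (-1) ×ˢ (univ : Set (EuclideanSpace ℝ (Fin 3))), ‖w z.1 z.2‖ₑ ^ p < ⊤) := by
  have hl0 : 0 < l := one_pos.trans hl
  -- pointwise invariance about the origin
  have haeξ : (fun z : ℝ × EuclideanSpace ℝ (Fin 3) => l • R.symm (w (l ^ 2 * z.1) (l • R z.2 + 0)))
      =ᵐ[volume.restrict (Iio (0 : ℝ) ×ˢ (univ : Set (EuclideanSpace ℝ (Fin 3))))]
      (fun z : ℝ × EuclideanSpace ℝ (Fin 3) => w z.1 z.2) := by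
    simpa only [add_zero] using hae
  -- (c ⇒ a), through the general statement with `ξ = 0`
  have hca : (∃ p : ℝ, 3 < p ∧ p < 9 ∧
      ∫⁻ z in Ioc (-l ^ 2) (-1) ×ˢ (univ : Set (EuclideanSpace ℝ (Fin 3))), ‖w z.1 z.2‖ₑ ^ p < ⊤) →
      ∀ y : EuclideanSpace ℝ (Fin 3), y ≠ l • R y → ¬ IsBackwardSingularPoint w ((0 : ℝ), y) := by
    rintro ⟨p, hp3, hp9, hfin⟩ y hy
    exact satelliteExclusion_of_stripIntegrable w q H C hsw hwg hI hdec hcl l R 0 hl haeξ p hp3 hp9 hfin y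
      (by simpa only [add_zero] using hy)
  -- (a ⇒ b): Chae–Wolf's scaling step, landed as `stub_decayOfSatelliteFree`
  have hab : (∀ y : EuclideanSpace ℝ (Fin 3), y ≠ l • R y → ¬ IsBackwardSingularPoint w ((0 : ℝ), y)) →
      ∃ C₀ : ℝ, HasTypeIDecay C₀ w := fun h =>
    stub_decayOfSatelliteFree w q C hdec hcl l R hl hae h
  -- (b ⇒ c)
  have hbc : (∃ C₀ : ℝ, HasTypeIDecay C₀ w) → ∃ p : ℝ, 3 < p ∧ p < 9 ∧
      ∫⁻ z in Ioc (-l ^ 2) (-1) ×ˢ (univ : Set (EuclideanSpace ℝ (Fin 3))), ‖w z.1 z.2‖ₑ ^ p < ⊤ := by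
    rintro ⟨C₀, hC₀⟩
    exact ⟨4, by norm_num, by norm_num, lintegral_strip_lt_top_of_hasTypeIDecay hC₀ (by norm_num) (by norm_num)⟩
  exact ⟨⟨hab, fun h => hca (hbc h)⟩, ⟨hbc, fun h => hab (hca h)⟩⟩

end Summit.NavierStokesRegularity.NavierStokesRegularity.Theorems.SymmetryModuliCountForcedSymmetry

end
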